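import Literature.Geometry.DiscreteGeometry.KissingAngleBounds
import HarnessLib

/-!
# Kertész 1994 — the lift penalty: a raised low point costs more azimuth beside a northern point
# than it can free beside another low point

Topic `Literature/Geometry/DiscreteGeometry`; second provefact instalment for the named fact
`kertesz1994_ninePointsHemisphere` (`KerteszNinePointsHemisphere.lean`), continuing
`KerteszNorthernPoints.lean`.  In the polar coordinates about the pole `e` used there (a northern
point of height `w = ⟪e, h⟫ > 1/2` has horizontal radius `r = √(1 − w²)`; a low point of height
`z = ⟪e, ℓ⟫ ∈ [0, 1/2)` has horizontal radius `s = √(1 − z²)`), the pairwise constraints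
`⟪·, ·⟫ ≤ 1/2` bound the AZIMUTH differences from below by

* high–low: `arccos ((1/2 − w z)/(r s))`, which at `z = 0` is `δ₀(w) = arccos (1/(2r))`;
* low–low: `arccos ((1/2 − z z')/(s s'))`, which at `z = z' = 0` is `π/3`.

Raising a low point (`z > 0`) INCREASES the first (to first order in `z`) and may DECREASE the second
(to second order, and only for unequal heights — "bunching").  This file PROVES the two elementary
estimates that make the trade quantitative, and their sum over a sector
`northern point – low – low – northern point` of the azimuth circle:

* `arccos_highLow_ge` — for `7/10 ≤ w`, `w² ≤ 3/4`, `0 ≤ z ≤ 1/2`: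
  `arccos ((1/2 − w z)/(r s)) ≥ arccos (1/(2r)) + z/2`;
* `arccos_lowLow_ge` — for `0 ≤ z, z' ≤ 1/2`:
  `arccos ((1/2 − z z')/(s s')) ≥ π/3 − (z − z')²/2`;
* **`sector_lift_penalty`** — hence the azimuth taken by such a sector exceeds its value for
  equatorial low points, `δ₀(w) + π/3 + δ₀(w')`, by at least `(z + z')/4`.

Both estimates are cosine comparisons (`cos (θ₀ + z/2) ≥ cos θ₀ (1 − z²/8) − sin θ₀ · z/2`,
`cos (π/3 − ε) ≥ ½ (1 − ε²/2) + (√3/2)(ε − ε³/6)`) followed by a polynomial inequality on a box.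
They are the analytic half of the `(2,2,2)` endgame of the azimuth-budget proof of Kertész's theorem
(blueprint: the cell record HOME/cf-lit/kertesz/BLUEPRINT.md of `run/shared/lean/pub/crystal3d-full`):
after them every "walk" term of the budget is at least its `z = 0` value, with equality only for
equatorial low points.  No definitions, no named facts.  WHAT THIS IS NOT: the discharge; the
budget's cover inequalities, the two small branch-and-bounds and the equality case at
`w = √(2/3)` remain.

## References
* G. Kertész, *Nine points on the hemisphere*, Colloq. Math. Soc. János Bolyai 63 (1994) 189–196;
  Zbl 0822.52005 (the range-narrowing). [`Kertesz1994`]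
* O. R. Musin, *The one-sided kissing number in four dimensions*, Period. Math. Hungar. 53 (2006)
  209–225, §2 (meridian projection). [`Musin2006`]
-/

noncomputable section

namespace Literature.Geometry.DiscreteGeometry

open Real

/-! ### High–low: the offset grows at least like `z/2` -/

/-- The polynomial inequality behind `arccos_highLow_ge`: for `7/10 ≤ w`, `w² ≤ 3/4`, `0 ≤ z ≤ 1/2`
and `u = √(3 − 4w²)`, `(1 − 2wz)² ≤ (1 − z²)(1 − u z/2 − z²/8)²`. [folklore] -/
private theorem highLow_poly {w z u : ℝ} (hw0 : 7 / 10 ≤ w) (hw1 : w ^ 2 ≤ 3 / 4) (hz0 : 0 ≤ z)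
    (hz1 : z ≤ 1 / 2) (hu0 : 0 ≤ u) (hu : u ^ 2 = 3 - 4 * w ^ 2) :
    (1 - 2 * w * z) ^ 2 ≤ (1 - z ^ 2) * (1 - u * z / 2 - z ^ 2 / 8) ^ 2 := by
  have hu1 : u ≤ 51 / 50 := by nlinarith
  -- the difference is `z · B` with
  -- `B = (4w − u) − (1/2 + 5w²) z + (9u/8) z² + (w² − 31/64) z³ − (u/8) z⁴ − z⁵/64`
  have key : (1 - z ^ 2) * (1 - u * z / 2 - z ^ 2 / 8) ^ 2 - (1 - 2 * w * z) ^ 2 =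
      z * ((4 * w - u) - (1 / 2 + 5 * w ^ 2) * z + 9 * u / 8 * z ^ 2 + (w ^ 2 - 31 / 64) * z ^ 3
        - u / 8 * z ^ 4 - z ^ 5 / 64) + z ^ 2 * (u ^ 2 - (3 - 4 * w ^ 2)) * (1 / 4 - z ^ 2 / 4) := by
    ring
  have hB : 0 ≤ (4 * w - u) - (1 / 2 + 5 * w ^ 2) * z + 9 * u / 8 * z ^ 2 + (w ^ 2 - 31 / 64) * z ^ 3
        - u / 8 * z ^ 4 - z ^ 5 / 64 := by
    have h1 : 0 ≤ 9 * u / 8 * z ^ 2 := by positivity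
    have h2 : 0 ≤ (w ^ 2 - 31 / 64) * z ^ 3 := mul_nonneg (by nlinarith) (by positivity)
    have hz2 : z ^ 2 ≤ 1 / 4 := by nlinarith
    have hz4 : z ^ 4 ≤ 1 / 16 := by
      have := pow_le_pow_left₀ (sq_nonneg z) hz2 2
      rw [← pow_mul] at this
      norm_num at this
      exact this
    have hz5 : z ^ 5 ≤ 1 / 32 := by
      have : z ^ 5 = z ^ 4 * z := by ring
      rw [this]
      nlinarith
    have h3 : u / 8 * z ^ 4 ≤ u / 128 := by nlinarith
    have h4 : (1 / 2 + 5 * w ^ 2) * z ≤ (1 / 2 + 5 * w ^ 2) / 2 := by nlinarith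
    nlinarith
  have hrest : 0 ≤ z ^ 2 * (u ^ 2 - (3 - 4 * w ^ 2)) * (1 / 4 - z ^ 2 / 4) := by
    rw [hu, sub_self, mul_zero, zero_mul]
  nlinarith [mul_nonneg hz0 hB]

/-- **High–low offset: raising the low point costs at least `z/2`.**  For a northern point of height
`w` with `7/10 ≤ w`, `w² ≤ 3/4` (colatitude between `30°` and `45.6°`) and a low point of height
`z ∈ [0, 1/2]`, the azimuth lower bound `arccos ((1/2 − w z)/(√(1 − w²) √(1 − z²)))` is at least
its equatorial value `arccos (1/(2 √(1 − w²)))` plus `z/2`.  Proof: with `θ₀ = arccos (1/(2r))`,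
`sin θ₀ = √(3 − 4w²)/(2r)`, compare cosines: `cos (θ₀ + z/2) ≥ (1/(2r))(1 − z²/8) − sin θ₀ · z/2`
and `highLow_poly`. [cite: Kertesz1994, proof (range-narrowing; the lift penalty at a northern point)] -/
theorem arccos_highLow_ge {w z : ℝ} (hw0 : 7 / 10 ≤ w) (hw1 : w ^ 2 ≤ 3 / 4) (hz0 : 0 ≤ z)
    (hz1 : z ≤ 1 / 2) :
    arccos (1 / (2 * √(1 - w ^ 2))) + z / 2 ≤
      arccos ((1 / 2 - w * z) / (√(1 - w ^ 2) * √(1 - z ^ 2))) := by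
  set r := √(1 - w ^ 2) with hrdef
  set s := √(1 - z ^ 2) with hsdef
  have hr2 : r ^ 2 = 1 - w ^ 2 := by rw [hrdef, Real.sq_sqrt (by nlinarith)]
  have hs2 : s ^ 2 = 1 - z ^ 2 := by rw [hsdef, Real.sq_sqrt (by nlinarith)]
  have hr0 : 0 ≤ r := Real.sqrt_nonneg _
  have hs0 : 0 ≤ s := Real.sqrt_nonneg _
  have hrpos : 0 < r := by nlinarith
  have hspos : 0 < s := by nlinarith
  have hr12 : 1 / 2 ≤ r := by nlinarith
  set x₀ : ℝ := 1 / (2 * r) with hx₀def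
  have hx₀0 : 0 < x₀ := by rw [hx₀def]; positivity
  have hx₀1 : x₀ ≤ 1 := by
    rw [hx₀def, div_le_one (by positivity)]; linarith
  set θ₀ := arccos x₀ with hθ₀def
  have hθ₀0 : 0 ≤ θ₀ := Real.arccos_nonneg _
  have hθ₀le : θ₀ ≤ π / 2 := by
    rw [hθ₀def]; exact Real.arccos_le_pi_div_two.2 hx₀0.le
  have hcosθ₀ : cos θ₀ = x₀ := by rw [hθ₀def, Real.cos_arccos (by linarith) hx₀1]
  -- `sin θ₀ = √(1 − x₀²) = u/(2r)` with `u = √(3 − 4w²)`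
  set u := √(3 - 4 * w ^ 2) with hudef
  have hu0 : 0 ≤ u := Real.sqrt_nonneg _
  have hu2 : u ^ 2 = 3 - 4 * w ^ 2 := by rw [hudef, Real.sq_sqrt (by nlinarith)]
  have hsinθ₀ : sin θ₀ = u / (2 * r) := by
    rw [hθ₀def, Real.sin_arccos]
    have h1 : 1 - x₀ ^ 2 = (u / (2 * r)) ^ 2 := by
      rw [hx₀def, div_pow, div_pow, hu2]
      field_simp
      nlinarith [hr2]
    rw [h1, Real.sqrt_sq (by positivity)]
  -- the target angle `θ₀ + z/2` lies in `[0, π]`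
  have hsum0 : 0 ≤ θ₀ + z / 2 := by linarith
  have hsumπ : θ₀ + z / 2 ≤ π := by linarith [Real.pi_gt_three]
  -- cosine comparison
  have hcos : (1 / 2 - w * z) / (r * s) ≤ cos (θ₀ + z / 2) := by
    rw [Real.cos_add, hcosθ₀, hsinθ₀]
    have hc : 1 - (z / 2) ^ 2 / 2 ≤ cos (z / 2) := Real.one_sub_sq_div_two_le_cos
    have hs' : sin (z / 2) ≤ z / 2 := Real.sin_le (by linarith)
    have hpoly := highLow_poly hw0 hw1 hz0 hz1 hu0 hu2
    -- `(1 − 2wz) ≤ s (1 − u z/2 − z²/8)` from the polynomial inequality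
    have hA0 : 0 ≤ 1 - u * z / 2 - z ^ 2 / 8 := by
      have hu1 : u ≤ 51 / 50 := by nlinarith
      nlinarith
    have hlin : 1 - 2 * w * z ≤ s * (1 - u * z / 2 - z ^ 2 / 8) := by
      have h1 : (1 - 2 * w * z) ^ 2 ≤ (s * (1 - u * z / 2 - z ^ 2 / 8)) ^ 2 := by
        rw [mul_pow, hs2]; exact hpoly
      have h2 : 0 ≤ s * (1 - u * z / 2 - z ^ 2 / 8) := mul_nonneg hs0 hA0
      have h3 := Real.le_sqrt_of_sq_le h1
      rwa [Real.sqrt_sq h2] at h3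
    -- divide by `2 r s > 0`
    have hlow : x₀ * (1 - (z / 2) ^ 2 / 2) - u / (2 * r) * (z / 2) ≤
        x₀ * cos (z / 2) - u / (2 * r) * sin (z / 2) := by
      have h1 : x₀ * (1 - (z / 2) ^ 2 / 2) ≤ x₀ * cos (z / 2) :=
        mul_le_mul_of_nonneg_left hc hx₀0.le
      have h2 : u / (2 * r) * sin (z / 2) ≤ u / (2 * r) * (z / 2) :=
        mul_le_mul_of_nonneg_left hs' (by positivity)
      linarith
    refine le_trans ?_ hlow
    have eq1 : (1 / 2 - w * z) / (r * s) = (1 - 2 * w * z) / s * (1 / (2 * r)) := by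
      field_simp
    have eq2 : x₀ * (1 - (z / 2) ^ 2 / 2) - u / (2 * r) * (z / 2) =
        (1 - u * z / 2 - z ^ 2 / 8) * (1 / (2 * r)) := by
      rw [hx₀def]
      field_simp
      ring
    have h3 : (1 - 2 * w * z) / s ≤ 1 - u * z / 2 - z ^ 2 / 8 := by
      rw [div_le_iff₀ hspos]
      linarith
    rw [eq1, eq2]
    exact mul_le_mul_of_nonneg_right h3 (by positivity)
  -- conclude with the antitone `arccos`
  calc arccos x₀ + z / 2 = arccos (cos (θ₀ + z / 2)) := by
        rw [Real.arccos_cos hsum0 hsumπ]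
    _ ≤ arccos ((1 / 2 - w * z) / (r * s)) := Real.arccos_le_arccos hcos

/-! ### Low–low: bunching frees at most `(z − z')²/2` -/

/-- The polynomial inequality behind `arccos_lowLow_ge`, in the variables `p = z z' ∈ [0, 1/4]` and
`q = (z − z')² ∈ [0, 1/4]` (`(1 − z²)(1 − z'²) = 1 − q − 2p + p²`):
`(1/2 − p)² ≤ (1 − q − 2p + p²)(1/2 + 2q/5)²`. [folklore] -/
private theorem lowLow_poly {p q : ℝ} (hp0 : 0 ≤ p) (hp1 : p ≤ 1 / 4) (hq0 : 0 ≤ q)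
    (hq1 : q ≤ 1 / 4) : (1 / 2 - p) ^ 2 ≤ (1 - q - 2 * p + p ^ 2) * (1 / 2 + 2 * q / 5) ^ 2 := by
  have hp1' : 0 ≤ 1 / 4 - p := sub_nonneg.2 hp1
  have hq1' : 0 ≤ 1 / 4 - q := sub_nonneg.2 hq1
  nlinarith [mul_nonneg hp0 hq0, mul_nonneg hp0 (mul_nonneg hq0 hq0), mul_nonneg hq0 hq0,
    mul_nonneg (mul_nonneg hq0 hq0) hq0, mul_nonneg hp0 hp1', mul_nonneg hp1' hq0,
    mul_nonneg hq1' hq0, mul_nonneg hq1' (mul_nonneg hq0 hq0), mul_nonneg (mul_nonneg hp0 hq0) hp1',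
    mul_nonneg (mul_nonneg hp0 hp0) hq0, mul_nonneg (mul_nonneg hq1' hq0) hp0]

/-- `cos (π/3 − ε) ≥ 1/2 + 4ε/5` for `0 ≤ ε ≤ 1/8` (`cos ε ≥ 1 − ε²/2`, `sin ε ≥ ε − ε³/6`,
`√3/2 > 0.85`). [folklore] -/
private theorem cos_pi_div_three_sub_ge {ε : ℝ} (h0 : 0 ≤ ε) (h1 : ε ≤ 1 / 8) :
    1 / 2 + 4 * ε / 5 ≤ cos (π / 3 - ε) := by
  rw [Real.cos_sub, Real.cos_pi_div_three, Real.sin_pi_div_three]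
  have hc : 1 - ε ^ 2 / 2 ≤ cos ε := Real.one_sub_sq_div_two_le_cos
  have h3 : (17 / 10 : ℝ) ≤ √3 := Real.le_sqrt_of_sq_le (by norm_num)
  rcases h0.eq_or_lt with h | h
  · rw [← h]; simp
  · have hs : ε - ε ^ 3 / 6 < sin ε := Real.sin_gt_sub_cube h
    have hs0 : 0 ≤ sin ε := Real.sin_nonneg_of_nonneg_of_le_pi h0 (by linarith [Real.pi_gt_three])
    have h4 : 17 / 10 * sin ε ≤ √3 * sin ε := mul_le_mul_of_nonneg_right h3 hs0
    nlinarith [mul_nonneg h0 h0, mul_nonneg (mul_nonneg h0 h0) h0]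

/-- **Low–low gap: bunching frees at most `(z − z')²/2`.**  For two low points of heights
`z, z' ∈ [0, 1/2]` the azimuth lower bound `arccos ((1/2 − z z')/(√(1 − z²) √(1 − z'²)))` is at least
`π/3 − (z − z')²/2` (and it is `≥ π/3` for equal heights: only UNEQUAL heights let two low points come
azimuthally closer than `60°`).  Proof: compare cosines — `(1/2 − z z')/(s s') ≤ 1/2 + (2/5)(z − z')²`
(`lowLow_poly`) and `1/2 + (2/5)(z − z')² ≤ cos (π/3 − (z − z')²/2)` (`cos_pi_div_three_sub_ge`).
[cite: Kertesz1994, proof (range-narrowing; the southern points)] [cite: Musin2006, §2 Thm 2 (proof)] -/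
theorem arccos_lowLow_ge {z z' : ℝ} (hz0 : 0 ≤ z) (hz1 : z ≤ 1 / 2) (hz0' : 0 ≤ z')
    (hz1' : z' ≤ 1 / 2) :
    π / 3 - (z - z') ^ 2 / 2 ≤ arccos ((1 / 2 - z * z') / (√(1 - z ^ 2) * √(1 - z' ^ 2))) := by
  set s := √(1 - z ^ 2) with hsdef
  set s' := √(1 - z' ^ 2) with hs'def
  have hs2 : s ^ 2 = 1 - z ^ 2 := by rw [hsdef, Real.sq_sqrt (by nlinarith)]
  have hs'2 : s' ^ 2 = 1 - z' ^ 2 := by rw [hs'def, Real.sq_sqrt (by nlinarith)]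
  have hs0 : 0 ≤ s := Real.sqrt_nonneg _
  have hs'0 : 0 ≤ s' := Real.sqrt_nonneg _
  have hspos : 0 < s := by nlinarith
  have hs'pos : 0 < s' := by nlinarith
  set ε := (z - z') ^ 2 / 2 with hεdef
  have hε0 : 0 ≤ ε := by positivity
  have hq1 : (z - z') ^ 2 ≤ 1 / 4 := by nlinarith
  have hε1 : ε ≤ 1 / 8 := by rw [hεdef]; linarith
  have hang0 : 0 ≤ π / 3 - ε := by linarith [Real.pi_gt_three]
  have hangπ : π / 3 - ε ≤ π := by linarith [Real.pi_gt_three]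
  -- `(1/2 − z z')/(s s') ≤ 1/2 + (2/5)(z − z')² = 1/2 + 4ε/5`
  have hT : (1 / 2 - z * z') / (s * s') ≤ 1 / 2 + 4 * ε / 5 := by
    rw [div_le_iff₀ (by positivity)]
    have hpoly := lowLow_poly (mul_nonneg hz0 hz0') (by nlinarith) (sq_nonneg (z - z')) hq1
    have hT0 : 0 ≤ (1 / 2 + 4 * ε / 5) * (s * s') := by positivity
    have h1 : (1 / 2 - z * z') ^ 2 ≤ ((1 / 2 + 4 * ε / 5) * (s * s')) ^ 2 := by
      have : ((1 / 2 + 4 * ε / 5) * (s * s')) ^ 2 =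
          (1 - (z - z') ^ 2 - 2 * (z * z') + (z * z') ^ 2) * (1 / 2 + 2 * (z - z') ^ 2 / 5) ^ 2 := by
        rw [mul_pow, mul_pow, hs2, hs'2, hεdef]; ring
      rw [this]; exact hpoly
    have h3 := Real.le_sqrt_of_sq_le h1
    rwa [Real.sqrt_sq hT0] at h3
  have hcos : (1 / 2 - z * z') / (s * s') ≤ cos (π / 3 - ε) :=
    hT.trans (cos_pi_div_three_sub_ge hε0 hε1)
  calc π / 3 - (z - z') ^ 2 / 2 = arccos (cos (π / 3 - ε)) := by
        rw [Real.arccos_cos hang0 hangπ]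
    _ ≤ arccos ((1 / 2 - z * z') / (s * s')) := Real.arccos_le_arccos hcos

/-! ### The sector penalty -/

/-- **The lift penalty of a sector.**  In the azimuth budget of a nine-point one-sided arrangement
(`KerteszNorthernPoints.lean`), a sector `northern point (height w) – low (height z) – low (height z')
– northern point (height w')` occupies at least `arccos ((1/2 − wz)/(r s)) + arccos ((1/2 − zz')/(s s'))
+ arccos ((1/2 − w'z')/(r' s'))` of azimuth; for `7/10 ≤ w, w'`, `w², w'² ≤ 3/4`, `0 ≤ z, z' ≤ 1/2`
this is at least the equatorial value `arccos (1/(2r)) + π/3 + arccos (1/(2r'))` PLUS `(z + z')/4`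
(`arccos_highLow_ge` twice, `arccos_lowLow_ge`, and `(z − z')² ≤ (z + z')/2`).  So raising low
points never buys azimuth in a sector, and the equatorial budget is attained only by equatorial low
points. [cite: Kertesz1994, proof (range-narrowing; "the latitudes … are completely determined")] -/
theorem sector_lift_penalty {w w' z z' : ℝ} (hw0 : 7 / 10 ≤ w) (hw1 : w ^ 2 ≤ 3 / 4)
    (hw0' : 7 / 10 ≤ w') (hw1' : w' ^ 2 ≤ 3 / 4) (hz0 : 0 ≤ z) (hz1 : z ≤ 1 / 2) (hz0' : 0 ≤ z')
    (hz1' : z' ≤ 1 / 2) :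
    arccos (1 / (2 * √(1 - w ^ 2))) + π / 3 + arccos (1 / (2 * √(1 - w' ^ 2))) + (z + z') / 4 ≤
      arccos ((1 / 2 - w * z) / (√(1 - w ^ 2) * √(1 - z ^ 2))) +
        arccos ((1 / 2 - z * z') / (√(1 - z ^ 2) * √(1 - z' ^ 2))) +
        arccos ((1 / 2 - w' * z') / (√(1 - w' ^ 2) * √(1 - z' ^ 2))) := by
  have h1 := arccos_highLow_ge hw0 hw1 hz0 hz1
  have h2 := arccos_lowLow_ge hz0 hz1 hz0' hz1'
  have h3 := arccos_highLow_ge hw0' hw1' hz0' hz1'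
  -- the second high–low term is stated with the factors in the order `√(1 − w'²) · √(1 − z'²)` and
  -- the product `w' z'`; `h3` matches after commuting nothing: it is literally the same expression.
  have hsq : (z - z') ^ 2 ≤ (z + z') / 2 := by
    nlinarith [abs_nonneg (z - z'), sq_abs (z - z'), abs_sub_le_iff.1 (le_refl |z - z'|)]
  linarith

end Literature.Geometry.DiscreteGeometry

end
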